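import Summits.AtomisticToContinuum.BoseEinsteinCondensation.Theorems.BECRewardDescentRewardChordBoundInvariantApproximationFRStep
import HarnessLib

/-!
# Stub `stub_invariantApproximationFR` (R5) of crux `RewardChordBound` (stmt-AtomisticToContinuum-12876), part 3/3:
# MaxFormApproximation for hard cores in the zero-momentum sector

**MaxFormApproximation for every repulsive finite-range pair potential, hard cores included, by translation-invariant
states**: for `L > 0`, a UNIT `η ∈ L²((ℝ/ℤ)^{3N})` (Haar probability measure), Bose-symmetric in momentum space,
invariant under all diagonal translations `T_b` (`translateLp`), with finite maximal-form energy
`Q_v(η) = maxForm v L η`, and `ε > 0`, there is a periodic Bose `C¹` trial state `Φ`, invariant under simultaneous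
translation of all particles (`Φ(x₁ + t, …, x_N + t) = Φ(X)`, zero total momentum), with
`periodicEnergy v Φ ≤ Q_v(η) + ε` and `‖ι₀Φ - η‖ ≤ ε` for the free embedding `ι₀ = formEmbed ∘ graphEmbed` of
`PeriodicFormDomain.lean` (auxiliary profile `0`). This is the translation-invariant twin of the landed
`stub_maxFormApproximationFiniteRange` (`…HardCoreExtensionMaxFormApproximationFiniteRange`), used by the lead's
composition to produce translation-invariant `C¹` near-minimisers from the (unique, hence invariant) rewarded ground
state of a hard-core Bose gas.

Proof. No hard radii (`hardRad v = ∅`): the interaction is integrable on the cell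
(`lintegral_norm_ne_top_of_hardRad_eq_empty`) and the landed zero-momentum integrable case
`exists_invariant_trialState_maxForm_approx` (`PeriodicMaxFormZeroMomentum.lean`) applies. Otherwise: clamp `η`
(`tendsto_clampLp`; the clamp commutes with `T_b`, `compLp_translateLp`, is bounded, Bose-symmetric and does not
increase the maximal form), get hard-layer decay (`hardLayer_decay_of_bound`), run the translation-invariant cut-off
step `inv_cutoffStep` (part 2, `…InvariantApproximationFRStep`), and normalise — scalar multiples of invariant core
functions are invariant.

References: B. Simon, *Maximal and minimal Schrödinger forms*, J. Operator Theory 1 (1979) 37–47, Thm. 2.1;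
[ReedSimonIV1978] Thm. XIII.64, §XIII.16.
-/

noncomputable section

open MeasureTheory Filter Set Complex UnitAddTorus
open scoped ENNReal NNReal Topology InnerProductSpace ComplexConjugate
open Literature.Analysis.FunctionSpaces Literature.Analysis.OperatorTheory Literature.Analysis.InnerProduct

namespace Summit.AtomisticToContinuum.BoseEinsteinCondensation.Cruxes.RewardChordBound.Birth

open Literature.MathematicalPhysics.QuantumManyBody.BoseGas
open Summit.AtomisticToContinuum.BoseEinsteinCondensation.Cruxes.HardCoreExtension.NearMinTower
open Summit.AtomisticToContinuum.BoseEinsteinCondensation.Cruxes.StaticResponseBound.UvThomsonForceWave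
  (measurable_zeroProfile lintegral_periodicInteraction_zero_ne_top)

-- The measure on `ℝ/ℤ` is the Haar PROBABILITY measure, as in `PeriodicFormDomain.lean`.
attribute [local instance] Literature.MathematicalPhysics.QuantumManyBody.BoseGas.formDomain_measureSpace
  Literature.MathematicalPhysics.QuantumManyBody.BoseGas.formDomain_isProbabilityMeasure
  Literature.MathematicalPhysics.QuantumManyBody.BoseGas.formDomain_isProbabilityMeasure_pi

namespace InvariantApproximationFR

/-- **MaxFormApproximation for hard cores in the zero-momentum sector** (house form, `volume`): for a repulsive
finite-range `v`, `L > 0`, a unit Bose-symmetric `η` invariant under all `T_b` with `maxForm v L η < ∞`, and `ε > 0`,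
a periodic Bose `C¹` trial state `Φ`, invariant under simultaneous translation of all particles, with
`periodicEnergy v Φ ≤ maxForm v L η + ε` and `‖ι₀Φ - η‖ ≤ ε`. [cite: ReedSimonIV1978, Thm. XIII.64] -/
theorem exists_invariant_trialState_maxForm_approx_finiteRange {v : ℝ → ℝ≥0∞} (hv : IsRepulsiveFiniteRange v)
    {N : ℕ} {L : ℝ} (hL : 0 < L) (η : Lp ℂ 2 (volume : Measure (UnitAddTorus (Fin N × Fin 3)))) (hη : ‖η‖ = 1)
    (hsymm : ∀ (σ : Equiv.Perm (Fin N)) (n : Fin N × Fin 3 → ℤ),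
      ⟪(mFourierLp 2 (fun p : Fin N × Fin 3 => n (σ p.1, p.2)) :
          Lp ℂ 2 (volume : Measure (UnitAddTorus (Fin N × Fin 3)))), η⟫_ℂ =
        ⟪(mFourierLp 2 n : Lp ℂ 2 (volume : Measure (UnitAddTorus (Fin N × Fin 3)))), η⟫_ℂ)
    (hinv : ∀ b : UnitAddTorus (Fin 3), translateLp b η = η) (hfin : maxForm v L η ≠ ⊤) {ε : ℝ} (hε : 0 < ε) :
    ∃ Φ : PeriodicTrialState N L,
      (∀ (X : Config N) (t : Space), Φ.ψ (fun i => X i + t) = Φ.ψ X) ∧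
      periodicEnergy v Φ ≤ maxForm v L η + ENNReal.ofReal ε ∧
      ‖formEmbed hL measurable_zeroProfile (lintegral_periodicInteraction_zero_ne_top N L)
          ⟨graphEmbed hL measurable_zeroProfile (lintegral_periodicInteraction_zero_ne_top N L)
            ⟨Φ.ψ, Φ.mem_periodicCore⟩,
            graphEmbed_mem_formDomain hL measurable_zeroProfile
              (lintegral_periodicInteraction_zero_ne_top N L) _⟩ - η‖ ≤ ε := by
  obtain ⟨R₀, hv0⟩ := hv.2
  rcases (hardRad v).eq_empty_or_nonempty with hS | hS
  · -- no hard radii: the interaction is integrable on the cell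
    obtain ⟨Φ, hΦ0, hΦE, hΦd⟩ := exists_invariant_trialState_maxForm_approx hL measurable_zeroProfile
      (lintegral_periodicInteraction_zero_ne_top N L) hv.1
      (lintegral_cellN_periodicInteraction_ne_top_of_lintegral_ne_top hL hv.1
        (lintegral_norm_ne_top_of_hardRad_eq_empty hv0 hS) N) η hη hsymm hinv hfin hε
    exact ⟨Φ, fun X t => (hasTotalMomentum_zero_iff.1 hΦ0) t X, hΦE, hΦd⟩
  -- notation
  set Q : ℝ≥0∞ := maxForm v L η with hQdef
  set q : ℝ := Q.toReal with hqdef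
  have hq0 : 0 ≤ q := ENNReal.toReal_nonneg
  have hQq : Q = ENNReal.ofReal q := (ENNReal.ofReal_toReal hfin).symm
  have hKV : maxFormKin L η ≠ ⊤ ∧ maxFormPot v L η ≠ ⊤ := ENNReal.add_ne_top.1 hfin
  -- the accuracy `e = min (1/4) (ε / (8q + 8))`
  set e : ℝ := min (1 / 4) (ε / (8 * q + 8)) with hedef
  have he0 : 0 < e := lt_min (by norm_num) (by positivity)
  have he4 : e ≤ 1 / 4 := min_le_left _ _
  have heε : e * (8 * q + 8) ≤ ε := by
    have h := min_le_right (1 / 4) (ε / (8 * q + 8))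
    rw [← hedef] at h
    have h88 : 0 < 8 * q + 8 := by positivity
    calc e * (8 * q + 8) ≤ ε / (8 * q + 8) * (8 * q + 8) := mul_le_mul_of_nonneg_right h h88.le
      _ = ε := div_mul_cancel₀ ε h88.ne'
  have he2 : 2 * e ≤ ε := by nlinarith [mul_nonneg he0.le hq0]
  -- the (translation-invariant) clamp truncation `ζ` within `e/2` of `η`
  obtain ⟨k, hk⟩ := ((tendsto_iff_norm_sub_tendsto_zero.1 (tendsto_clampLp η)).eventually
    (Iic_mem_nhds (half_pos he0))).exists
  obtain ⟨ζ, hζ⟩ : ∃ ζ : Lp ℂ 2 (volume : Measure (UnitAddTorus (Fin N × Fin 3))),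
      ζ = (lipschitzWith_clampC (k : ℝ)).compLp (clampC_zero (Nat.cast_nonneg k)) η := ⟨_, rfl⟩
  have hζK := tsum_kinetic_clampLp_le (L := L) η k
  have hζV := lintegral_pot_clampLp_le η k (fun t => periodicInteraction v L (fromUnitTorusN L t))
  have hζsymm := inner_symm_clampLp η k hsymm
  have hζbd := ae_norm_clampLp_le η k
  have hζinv : ∀ b : UnitAddTorus (Fin 3),
      translateLp b ((lipschitzWith_clampC (k : ℝ)).compLp (clampC_zero (Nat.cast_nonneg k)) η) =
        (lipschitzWith_clampC (k : ℝ)).compLp (clampC_zero (Nat.cast_nonneg k)) η := fun b => by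
    rw [← compLp_translateLp, hinv b]
  rw [← hζ] at hk hζK hζV hζsymm hζbd hζinv
  replace hk : ‖ζ - η‖ ≤ e / 2 := hk
  -- hard-layer decay of `ζ` and the invariant cut-off step at accuracy `e/2`
  have hlayer : ∀ ε' : ℝ, 0 < ε' → ∃ s₀ : ℝ, 0 < s₀ ∧ ∀ s : ℝ, 0 < s → s ≤ s₀ →
      ∫⁻ t in fromUnitTorusN L ⁻¹' (hardLayer v L s : Set (Config N)),
        ((‖(ζ : UnitAddTorus (Fin N × Fin 3) → ℂ) t‖₊ : ℝ≥0∞)) ^ 2 ≤ ENNReal.ofReal (ε' * s ^ 2) := fun ε' hε' =>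
    hardLayer_decay_of_bound hL hv.1 (fun b hb => le_of_mem_hardRad hv0 hb) hS ζ hζbd
      (ne_top_of_le_ne_top hKV.1 hζK) (ne_top_of_le_ne_top hKV.2 hζV) hε'
  obtain ⟨Φc, hΦcinv, hΦcE, hΦcd⟩ :=
    inv_cutoffStep v hv.1 R₀ hv0 N L hL ζ hζsymm hζinv hlayer (e / 2) (half_pos he0)
  obtain ⟨P, hP⟩ : ∃ P : Lp ℂ 2 (volume : Measure (UnitAddTorus (Fin N × Fin 3))),
      P = formEmbed hL measurable_zeroProfile (lintegral_periodicInteraction_zero_ne_top N L)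
        ⟨graphEmbed hL measurable_zeroProfile (lintegral_periodicInteraction_zero_ne_top N L) Φc,
          graphEmbed_mem_formDomain hL measurable_zeroProfile (lintegral_periodicInteraction_zero_ne_top N L) Φc⟩ :=
    ⟨_, rfl⟩
  rw [← hP] at hΦcE hΦcd
  have hQP : maxForm v L P ≤ ENNReal.ofReal (1 + e / 2) * Q + ENNReal.ofReal (e / 2) :=
    hΦcE.trans (add_le_add (mul_le_mul_right (add_le_add hζK hζV) _) le_rfl)
  have hdist : ‖P - η‖ ≤ e :=
    calc ‖P - η‖ ≤ ‖P - ζ‖ + ‖ζ - η‖ := norm_sub_le_norm_sub_add_norm_sub _ _ _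
      _ ≤ e / 2 + e / 2 := add_le_add hΦcd hk
      _ = e := add_halves e
  -- `‖P‖` is close to `1`; normalise
  have hPnorm : |‖P‖ - 1| ≤ e := by
    rw [← hη]
    exact (abs_norm_sub_norm_le P η).trans hdist
  have hPpos : 0 < ‖P‖ := by
    have := (abs_le.1 hPnorm).1
    linarith
  set c : ℝ := ‖P‖⁻¹ with hcdef
  have hc0 : 0 < c := inv_pos.2 hPpos
  set Φc' : periodicCore N L := ((c : ℝ) : ℂ) • Φc with hΦc'
  have hιΦ : formEmbed hL measurable_zeroProfile (lintegral_periodicInteraction_zero_ne_top N L)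
      ⟨graphEmbed hL measurable_zeroProfile (lintegral_periodicInteraction_zero_ne_top N L) Φc',
        graphEmbed_mem_formDomain hL measurable_zeroProfile (lintegral_periodicInteraction_zero_ne_top N L) Φc'⟩ =
      ((c : ℝ) : ℂ) • P := by
    rw [hP, ← map_smul]
    congr 1
    apply Subtype.ext
    simp only [hΦc', map_smul, SetLike.mk_smul_mk]
  have h1 : ‖formEmbed hL measurable_zeroProfile (lintegral_periodicInteraction_zero_ne_top N L)
      ⟨graphEmbed hL measurable_zeroProfile (lintegral_periodicInteraction_zero_ne_top N L) Φc',
        graphEmbed_mem_formDomain hL measurable_zeroProfile (lintegral_periodicInteraction_zero_ne_top N L) Φc'⟩‖ =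
      1 := by
    rw [hιΦ, norm_smul, Complex.norm_real, Real.norm_of_nonneg hc0.le, hcdef, inv_mul_cancel₀ hPpos.ne']
  have hcore : (⟨(PeriodicTrialState.ofCore hL measurable_zeroProfile (lintegral_periodicInteraction_zero_ne_top N L)
      Φc' h1).ψ, (PeriodicTrialState.ofCore hL measurable_zeroProfile (lintegral_periodicInteraction_zero_ne_top N L)
      Φc' h1).mem_periodicCore⟩ : periodicCore N L) = Φc' := rfl
  refine ⟨PeriodicTrialState.ofCore hL measurable_zeroProfile (lintegral_periodicInteraction_zero_ne_top N L) Φc' h1,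
    ?_, ?_, ?_⟩
  · -- invariance under the diagonal translations
    intro X t
    show ((Φc' : periodicCore N L) : Config N → ℂ) (fun i => X i + t) = ((Φc' : periodicCore N L) : Config N → ℂ) X
    rw [hΦc', Submodule.coe_smul, Pi.smul_apply, Pi.smul_apply, hΦcinv X t]
  · -- the energy
    rw [periodicEnergy_eq_maxForm hL measurable_zeroProfile (lintegral_periodicInteraction_zero_ne_top N L) hv.1, hcore,
      hιΦ, tsum_weight_inner_smul, lintegral_weight_smul_sq, ← mul_add, Complex.norm_real, Real.norm_of_nonneg hc0.le]
    change ENNReal.ofReal (c ^ 2) * maxForm v L P ≤ Q + ENNReal.ofReal ε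
    -- `c² ((1 + e/2) Q + e/2) ≤ (1 + 6e)((1 + e/2) q + e/2) ≤ q + ε`
    have hc2 : c ^ 2 ≤ 1 + 6 * e := by
      have hle : 1 - e ≤ ‖P‖ := by linarith [(abs_le.1 hPnorm).1]
      have h1e : 0 < 1 - e := by linarith
      calc c ^ 2 = (‖P‖ ^ 2)⁻¹ := by rw [hcdef, inv_pow]
        _ ≤ ((1 - e) ^ 2)⁻¹ := by
            refine inv_anti₀ (by positivity) ?_
            exact pow_le_pow_left₀ h1e.le hle 2
        _ ≤ 1 + 6 * e := inv_sq_one_sub_le he0.le he4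
    have hreal : (1 + 6 * e) * ((1 + e / 2) * q + e / 2) ≤ q + ε := by
      have h1 : 0 ≤ (1 / 4 - e) * (e * q) := mul_nonneg (by linarith) (mul_nonneg he0.le hq0)
      have h2 : 0 ≤ (1 / 4 - e) * e := mul_nonneg (by linarith) he0.le
      have h3 : 0 ≤ e * q := mul_nonneg he0.le hq0
      nlinarith [h1, h2, h3, heε, he0.le]
    calc ENNReal.ofReal (c ^ 2) * maxForm v L P
        ≤ ENNReal.ofReal (1 + 6 * e) * (ENNReal.ofReal (1 + e / 2) * Q + ENNReal.ofReal (e / 2)) :=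
          mul_le_mul' (ENNReal.ofReal_le_ofReal hc2) hQP
      _ = ENNReal.ofReal ((1 + 6 * e) * ((1 + e / 2) * q + e / 2)) := by
          rw [hQq, ← ENNReal.ofReal_mul (by linarith), ← ENNReal.ofReal_add (by positivity) (by positivity),
            ← ENNReal.ofReal_mul (by linarith)]
      _ ≤ ENNReal.ofReal (q + ε) := ENNReal.ofReal_le_ofReal hreal
      _ = Q + ENNReal.ofReal ε := by rw [ENNReal.ofReal_add hq0 hε.le, ← hQq]
  · -- the distance
    rw [hcore, hιΦ]
    calc ‖((c : ℝ) : ℂ) • P - η‖ ≤ ‖((c : ℝ) : ℂ) • P - P‖ + ‖P - η‖ := norm_sub_le_norm_sub_add_norm_sub _ _ _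
      _ = |c - 1| * ‖P‖ + ‖P - η‖ := by
          rw [show ((c : ℝ) : ℂ) • P - P = (((c - 1 : ℝ)) : ℂ) • P by
            rw [Complex.ofReal_sub, Complex.ofReal_one, sub_smul, one_smul], norm_smul, Complex.norm_real,
            Real.norm_eq_abs]
      _ = |1 - ‖P‖| + ‖P - η‖ := by
          rw [hcdef, show ‖P‖⁻¹ - 1 = (1 - ‖P‖) * ‖P‖⁻¹ by field_simp, abs_mul, abs_of_pos (inv_pos.2 hPpos),
            mul_assoc, inv_mul_cancel₀ hPpos.ne', mul_one]
      _ ≤ e + e := add_le_add (by rw [abs_sub_comm]; exact hPnorm) hdist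
      _ ≤ ε := by linarith

end InvariantApproximationFR

/-- **stub R5 — `InvariantApproximationFR` (NEW, worker): MaxFormApproximation for hard cores, translation-invariant
version.** For a repulsive finite-range `v`, `L > 0`, a unit Bose-symmetric `η ∈ L²((ℝ/ℤ)^{3N})` with finite
maximal-form energy which is invariant under the diagonal translations `T_b`, and `ε > 0`, there is a periodic Bose
`C¹` trial state `Φ`, invariant under simultaneous translation of all particles, with `periodicEnergy v Φ ≤ Q_v(η) + ε`
and `‖ι₀Φ - η‖ ≤ ε` (free embedding `ι₀`). Twin of `stub_maxFormApproximationFiniteRange`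
(`…HardCoreExtensionMaxFormApproximationFiniteRange(Step|Bookkeeping)`): the clamp `clampC k ∘ η`, the hard-layer
cut-off (`exists_inv_hardLayer_cutoff`) and the zero-momentum symmetric trigonometric approximants
(`exists_inv_symm_trigPoly_maxForm_approx`) all commute with / preserve the diagonal translations; no hard radii:
`exists_invariant_trialState_maxForm_approx` (`PeriodicMaxFormZeroMomentum.lean`).
[cite: Simon1979Forms, Thm. 2.1; ReedSimonIV1978, Thm. XIII.64 and §XIII.16] -/
theorem stub_invariantApproximationFR :
    ∀ v : ℝ → ENNReal, Literature.MathematicalPhysics.QuantumManyBody.BoseGas.IsRepulsiveFiniteRange v →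
      ∀ (N : ℕ) (L : ℝ) (hL : 0 < L),
      ∀ η : MeasureTheory.Lp ℂ 2 (MeasureTheory.Measure.pi fun _ : Fin N × Fin 3 =>
          (AddCircle.haarAddCircle : MeasureTheory.Measure UnitAddCircle)), ‖η‖ = 1 →
        (∀ (σ : Equiv.Perm (Fin N)) (n : Fin N × Fin 3 → ℤ),
          ⟪(UnitAddTorus.mFourierLp 2 (fun p : Fin N × Fin 3 => n (σ p.1, p.2)) :
              MeasureTheory.Lp ℂ 2 (MeasureTheory.Measure.pi fun _ : Fin N × Fin 3 =>
                (AddCircle.haarAddCircle : MeasureTheory.Measure UnitAddCircle))), η⟫_ℂ =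
            ⟪(UnitAddTorus.mFourierLp 2 n : MeasureTheory.Lp ℂ 2 (MeasureTheory.Measure.pi fun _ : Fin N × Fin 3 =>
                (AddCircle.haarAddCircle : MeasureTheory.Measure UnitAddCircle))), η⟫_ℂ) →
        (∀ b : UnitAddTorus (Fin 3), Literature.MathematicalPhysics.QuantumManyBody.BoseGas.translateLp b η = η) →
        Literature.MathematicalPhysics.QuantumManyBody.BoseGas.maxForm v L η ≠ ⊤ →
        ∀ ε : ℝ, 0 < ε → ∃ Φ : Literature.MathematicalPhysics.QuantumManyBody.BoseGas.PeriodicTrialState N L,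
          (∀ (X : Literature.MathematicalPhysics.QuantumManyBody.BoseGas.Config N) (t : EuclideanSpace ℝ (Fin 3)),
            Φ.ψ (fun i => X i + t) = Φ.ψ X) ∧
          Literature.MathematicalPhysics.QuantumManyBody.BoseGas.periodicEnergy v Φ ≤
            Literature.MathematicalPhysics.QuantumManyBody.BoseGas.maxForm v L η + ENNReal.ofReal ε ∧
          ‖Literature.MathematicalPhysics.QuantumManyBody.BoseGas.formEmbed hL
              Summit.AtomisticToContinuum.BoseEinsteinCondensation.Cruxes.StaticResponseBound.UvThomsonForceWave.measurable_zeroProfile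
              (Summit.AtomisticToContinuum.BoseEinsteinCondensation.Cruxes.StaticResponseBound.UvThomsonForceWave.lintegral_periodicInteraction_zero_ne_top N L)
              ⟨Literature.MathematicalPhysics.QuantumManyBody.BoseGas.graphEmbed hL
                Summit.AtomisticToContinuum.BoseEinsteinCondensation.Cruxes.StaticResponseBound.UvThomsonForceWave.measurable_zeroProfile
                (Summit.AtomisticToContinuum.BoseEinsteinCondensation.Cruxes.StaticResponseBound.UvThomsonForceWave.lintegral_periodicInteraction_zero_ne_top N L)
                ⟨Φ.ψ, Φ.mem_periodicCore⟩,
                Literature.MathematicalPhysics.QuantumManyBody.BoseGas.graphEmbed_mem_formDomain hL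
                  Summit.AtomisticToContinuum.BoseEinsteinCondensation.Cruxes.StaticResponseBound.UvThomsonForceWave.measurable_zeroProfile
                  (Summit.AtomisticToContinuum.BoseEinsteinCondensation.Cruxes.StaticResponseBound.UvThomsonForceWave.lintegral_periodicInteraction_zero_ne_top N L) _⟩ - η‖ ≤ ε :=
  fun _ hv _ _ hL η hη hsymm hinv hfin _ hε =>
    InvariantApproximationFR.exists_invariant_trialState_maxForm_approx_finiteRange hv hL η hη hsymm hinv hfin hε

end Summit.AtomisticToContinuum.BoseEinsteinCondensation.Cruxes.RewardChordBound.Birth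

end
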